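import Mathlib
import HarnessLib
import Summits.HubbardSuperconductivity.HubbardSuperconductivity.Theorems.KLProgrammeKLRegimeTwoPointAssemblyMatsubaraAllU

/-!
# The all-`U` Matsubara (`M → ∞`) limit of the Grassmann two-point numerator at GENERAL external imaginary times — the
# Grassmann half of the τ-resolved bridge (seat hubbard-kl-k3c5-p2, g2)

Route `KLProgramme`, child 5 `KLRegimeVolumeLimitV11` (stmt-HubbardSuperconductivity-19826), clause (i) of `FinalTwoLegVolLimit`.  By
`…ThermalGreenHubbardTorus` the Hamiltonian (`M = ∞`) shadow of the VL carrier is bounded at all frequencies, uniformly in the volume, for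
every coupling; to carry that to the finite-`M` carrier `klSelfEnergy … (nScales β + 1)` (a frequency-RESOLVED object) one needs the
`M → ∞` identification of the Grassmann two-point function at GENERAL external times `⟨ψ⁺_{(x⃗,s)σ} ψ⁻_{(y⃗,0)σ'}⟩_M`, not only at equal
times (t2's `…TwoPointAssemblyMatsubaraAllU`, `s = 0`).  This file supplies the GRASSMANN HALF for every real `U`: the numerator
`N_M(s_x, s_y) = ∫dμ_{C_M} ψ⁺_{(x⃗ₑ,s_x)σ} ψ⁻_{(y⃗ₑ,s_y)σ'} e^{−V_M(U)}` converges, as `M → ∞`, to the limit-determinant series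
`Σ'_n ((−1)ⁿ/n!) Uⁿ Σ_{x⃗} ∫_{[0,β]ⁿ} det[vertexLimitEntry(…; τ, s_x, s_y)]` for all `s_x, s_y ∈ [0, β)` — t2's domination
(`norm_gaussExpect_twoPoint_pow_le_allU`: mixed Gram–Hadamard rows, one cluster sum per vertex, Touchard majorant) is literally
time-independent: the two external points enter only through `Fin.append τ ![s_x, s_y] ∈ [0, β]^{n+2}`.  Proofs are t2's, with the two
external times generalised (`norm_gaussExpect_twoPoint_pow_le_allU_time`, `tendsto_gaussExpect_twoPoint_mul_grassmannExp_allU_time`).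
What remains for the τ-resolved bridge is the HAMILTONIAN half: the identification of the limit series at external times `(s, 0)` with
`e^{−βUL²/4}·Tr(e^{−(β−s)H'} c†_{x⃗σ} e^{−sH'} c_{y⃗σ'})/Tr e^{−βH₀}` (the `s`-analogue of `hasSum_twoPointLimitDet_series`).  Everything is
proved; no definition.
-/

namespace Summit.HubbardSuperconductivity.HubbardSuperconductivity.Theorems.MatsubaraAllU

set_option linter.dupNamespace false -- summit = problem name (single-conjunct summit), D-0017

open MeasureTheory Finset Filter Topology Literature.MathematicalPhysics.QuantumLattice
  Literature.Probability.LatticeModels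
open Literature.MathematicalPhysics.QuantumLattice.GrassmannAlgebra
open scoped Nat ComplexOrder

noncomputable section

/-- **Reduction of the cluster sum over `n+2` points to the internal one, for ARBITRARY external times `e`** (t2's
`sum_prod_sum_append_le` is `e = (0, 0)`; only `0 ≤ w ≤ K₀` is used):
`Σ_{T⊆[n+2]} ∏_{a∈T} Σ_{b∈[n+2]} w(τ'_b − τ'_a) ≤ (1+(n+2)K₀)² (1+2K₀)ⁿ Σ_{T⊆[n]} ∏_{a∈T} Σ_{b∈[n]} w(τ_b − τ_a)`, `τ' = (τ, e₀, e₁)`. -/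
theorem sum_prod_sum_append_le_time {n : ℕ} (wr : ℝ → ℝ) (hw0 : ∀ u, 0 ≤ wr u) (K₀ : ℝ) (hK : ∀ u, wr u ≤ K₀)
    (τ : Fin n → ℝ) (e : Fin 2 → ℝ) :
    ∑ T : Finset (Fin (n + 2)), ∏ a ∈ T, ∑ b : Fin (n + 2),
        wr ((Fin.append τ e : Fin (n + 2) → ℝ) b - (Fin.append τ e : Fin (n + 2) → ℝ) a) ≤
      (1 + (n + 2 : ℝ) * K₀) ^ 2 * (1 + 2 * K₀) ^ n *
        ∑ T : Finset (Fin n), ∏ a ∈ T, ∑ b : Fin n, wr (τ b - τ a) := by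
  classical
  have hK0 : 0 ≤ K₀ := (hw0 0).trans (hK 0)
  set τ' : Fin (n + 2) → ℝ := Fin.append τ e with hτ'
  set g' : Fin (n + 2) → ℝ := fun a => ∑ b : Fin (n + 2), wr (τ' b - τ' a) with hg'
  set g : Fin n → ℝ := fun a => ∑ b : Fin n, wr (τ b - τ a) with hg
  have hg0 : ∀ a, 0 ≤ g a := fun a => Finset.sum_nonneg fun b _ => hw0 _
  have hg'0 : ∀ a, 0 ≤ g' a := fun a => Finset.sum_nonneg fun b _ => hw0 _
  have hleft : ∀ a₀ : Fin n, τ' (Fin.castAdd 2 a₀) = τ a₀ := fun a₀ => by simp [hτ']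
  -- internal points: `g'(castAdd a₀) ≤ g(a₀) + 2K₀`
  have hint : ∀ a₀ : Fin n, g' (Fin.castAdd 2 a₀) ≤ g a₀ + 2 * K₀ := by
    intro a₀
    simp only [hg', Fin.sum_univ_add, hleft]
    refine add_le_add le_rfl ?_
    calc ∑ k : Fin 2, wr (τ' (Fin.natAdd n k) - τ a₀) ≤ ∑ _k : Fin 2, K₀ := Finset.sum_le_sum fun k _ => hK _
      _ = 2 * K₀ := by simp [two_mul]
  -- external points: `g'(natAdd k) ≤ (n+2)K₀`
  have hext : ∀ k : Fin 2, g' (Fin.natAdd n k) ≤ (n + 2 : ℝ) * K₀ := by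
    intro k
    calc g' (Fin.natAdd n k) ≤ ∑ _b : Fin (n + 2), K₀ := Finset.sum_le_sum fun b _ => hK _
      _ = (n + 2 : ℝ) * K₀ := by simp
  rw [sum_univ_prod_eq_prod_one_add, sum_univ_prod_eq_prod_one_add, Fin.prod_univ_add]
  have h1 : ∏ a₀ : Fin n, (1 + g' (Fin.castAdd 2 a₀)) ≤ (1 + 2 * K₀) ^ n * ∏ a₀ : Fin n, (1 + g a₀) := by
    calc ∏ a₀ : Fin n, (1 + g' (Fin.castAdd 2 a₀)) ≤ ∏ a₀ : Fin n, ((1 + 2 * K₀) * (1 + g a₀)) :=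
          Finset.prod_le_prod (fun a₀ _ => by linarith [hg'0 (Fin.castAdd 2 a₀)]) fun a₀ _ => by
            nlinarith [hint a₀, hg0 a₀, hK0]
      _ = (1 + 2 * K₀) ^ n * ∏ a₀ : Fin n, (1 + g a₀) := by
          rw [Finset.prod_mul_distrib, Finset.prod_const, Finset.card_univ, Fintype.card_fin]
  have h2 : ∏ k : Fin 2, (1 + g' (Fin.natAdd n k)) ≤ (1 + (n + 2 : ℝ) * K₀) ^ 2 := by
    calc ∏ k : Fin 2, (1 + g' (Fin.natAdd n k)) ≤ ∏ _k : Fin 2, (1 + (n + 2 : ℝ) * K₀) :=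
          Finset.prod_le_prod (fun k _ => by linarith [hg'0 (Fin.natAdd n k)]) fun k _ => by linarith [hext k]
      _ = (1 + (n + 2 : ℝ) * K₀) ^ 2 := by
          rw [Finset.prod_const, Finset.card_univ, Fintype.card_fin]
  have h10 : 0 ≤ ∏ a₀ : Fin n, (1 + g' (Fin.castAdd 2 a₀)) :=
    Finset.prod_nonneg fun a₀ _ => by linarith [hg'0 (Fin.castAdd 2 a₀)]
  calc (∏ a₀ : Fin n, (1 + g' (Fin.castAdd 2 a₀))) * ∏ k : Fin 2, (1 + g' (Fin.natAdd n k))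
      ≤ ((1 + 2 * K₀) ^ n * ∏ a₀ : Fin n, (1 + g a₀)) * (1 + (n + 2 : ℝ) * K₀) ^ 2 :=
        mul_le_mul h1 h2 (Finset.prod_nonneg fun k _ => by linarith [hg'0 (Fin.natAdd n k)])
          (mul_nonneg (pow_nonneg (by linarith) _) (Finset.prod_nonneg fun a₀ _ => by linarith [hg0 a₀]))
    _ = (1 + (n + 2 : ℝ) * K₀) ^ 2 * (1 + 2 * K₀) ^ n * ∏ a₀ : Fin n, (1 + g a₀) := by ring

variable {L : ℕ} [NeZero L]

/-- **Domination of the two-point moments for EVERY coupling, general external times `s_x, s_y ∈ [0, β]`** (t2's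
`norm_gaussExpect_twoPoint_pow_le_allU` with the two external times freed): there are `K₀ ≥ 0` and `ε_M ≥ 0`, `ε_M → 0`, with, for all
`M, n` and every `r > 0`, `‖∫dμ_{C_M} ψ⁺_{(x⃗ₑ,s_x)}ψ⁻_{(y⃗ₑ,s_y)} Vⁿ‖ ≤ n!·(64(1+2K₀)² e^{βr} exp((βK₀+nε_M) r e^{βK₀r}))·(256|U|L²(1+2K₀)/r)ⁿ`. -/
theorem norm_gaussExpect_twoPoint_pow_le_allU_time {β : ℝ} (hβ : 0 < β) (μ U : ℝ) (σ σ' : Fin 2)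
    (xe ye : TorusSite 2 L) {sx sy : ℝ} (hsx : sx ∈ Set.Icc (0 : ℝ) β) (hsy : sy ∈ Set.Icc (0 : ℝ) β) :
    ∃ (K₀ : ℝ) (ε : ℕ → ℝ), 0 ≤ K₀ ∧ (∀ M, 0 ≤ ε M) ∧ Tendsto ε atTop (𝓝 0) ∧
      ∀ (M n : ℕ) (r : ℝ), 0 < r →
        ‖gaussExpect ℂ (hubbardCovariance L M β μ 0)
            (positionField L M β 0 σ xe sx * positionField L M β 1 σ' ye sy * hubbardInteraction L M β U ^ n)‖ ≤
          (n ! : ℝ) * (64 * (1 + 2 * K₀) ^ 2 * Real.exp (β * r) *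
              Real.exp ((β * K₀ + n * ε M) * r * Real.exp (β * K₀ * r))) *
            (256 * |U| * (L : ℝ) ^ 2 * (1 + 2 * K₀) / r) ^ n := by
  classical
  obtain ⟨K₀, wr, hK₀, hwm, hw0, hwK, hwI, hshift, hlim, hkey⟩ := exists_remainderKernel L hβ μ
  refine ⟨K₀, fun M => ∫ u, wr M u, hK₀, fun M => integral_nonneg fun u => hw0 M u, hlim, ?_⟩
  intro M n r hr
  have hcard : ((Fintype.card (Fin n → TorusSite 2 L) : ℕ) : ℝ) = ((L : ℝ) ^ 2) ^ n := by
    rw [Fintype.card_fun, Fintype.card_fin, Nat.cast_pow, Fintype.card_pi, prod_const, ZMod.card, card_univ,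
      Fintype.card_fin, Nat.cast_pow]
  have hfibP : ∀ a : Fin (n + 2), (univ.filter fun i : Fin (n * 2 + 1) => (twoPointPlusEnum n σ i).1 = a).card ≤ 2 :=
    card_filter_fst_le_two _ (twoPointPlusEnum_injective n σ)
  have hfibQ : ∀ a : Fin (n + 2), (univ.filter fun j : Fin (n * 2 + 1) => (twoPointMinusEnum n σ' j).1 = a).card ≤ 2 :=
    card_filter_fst_le_two _ (twoPointMinusEnum_injective n σ')
  have hI := integral_sum_prod_sum_le (m := n) β hβ.le (wr M) (hwm M) (hw0 M) K₀ (∫ u, wr M u) hK₀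
    (integral_nonneg fun u => hw0 M u) (hwK M) (hshift M) r hr
  set Cn : ℝ := (1 + (n + 2 : ℝ) * K₀) ^ 2 * (1 + 2 * K₀) ^ n with hCn
  have hCn0 : 0 ≤ Cn := by positivity
  have hdet : ∀ xv : Fin n → TorusSite 2 L, ‖∫ τ in Set.Icc (0 : Fin n → ℝ) (fun _ => β),
      (Matrix.of fun i j : Fin (n * 2 + 1) =>
        -((vertexSubMatrix L M β (Fin.append xv ![xe, ye]) (Fin.append τ ![sx, sy])).transpose *
            hubbardCovariance L M β μ 0 *
            vertexSubMatrix L M β (Fin.append xv ![xe, ye]) (Fin.append τ ![sx, sy]))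
          ((twoPointPlusEnum n σ i, 0) : VertexLeg (n + 2)) ((twoPointMinusEnum n σ' j, 1) : VertexLeg (n + 2))).det‖ ≤
      (4 : ℝ) ^ (n * 2 + 1) * 4 ^ (n + 2) * (Cn * ((n ! : ℝ) / r ^ n * Real.exp (β * r) *
        Real.exp ((β * K₀ + n * ∫ u, wr M u) * r * Real.exp (β * K₀ * r)))) := by
    intro xv
    refine (norm_integral_le_of_norm_le (((integrableOn_sum_prod_sum β (wr M) (hwm M) (hw0 M) K₀ (hwK M)).const_mul
      ((4 : ℝ) ^ (n * 2 + 1) * 4 ^ (n + 2) * Cn))) ?_).trans ?_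
    · refine (ae_restrict_iff' measurableSet_Icc).2 (ae_of_all _ fun τ hτ => ?_)
      have hτ' : ∀ a : Fin (n + 2), (Fin.append τ ![sx, sy] : Fin (n + 2) → ℝ) a ∈ Set.Icc (0 : ℝ) β := by
        intro a
        refine Fin.addCases (fun a₀ => ?_) (fun k => ?_) a
        · rw [Fin.append_left]; exact ⟨hτ.1 a₀, hτ.2 a₀⟩
        · rw [Fin.append_right]
          fin_cases k
          · simpa using hsx
          · simpa using hsy
      refine (norm_det_vertexWick_le_sum_prod hβ μ _ _ hτ' _ _ hfibP hfibQ (wr M) (hw0 M) (hkey M)).trans ?_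
      rw [mul_assoc ((4 : ℝ) ^ (n * 2 + 1) * 4 ^ (n + 2)) Cn]
      exact mul_le_mul_of_nonneg_left (sum_prod_sum_append_le_time (wr M) (hw0 M) K₀ (hwK M) τ ![sx, sy]) (by positivity)
    · rw [integral_const_mul, mul_assoc]
      exact mul_le_mul_of_nonneg_left (mul_le_mul_of_nonneg_left hI hCn0) (by positivity)
  have h64 : (4 : ℝ) ^ (n * 2 + 1) * 4 ^ (n + 2) = 64 * 64 ^ n := by
    have h : (64 : ℝ) ^ n = (4 ^ 2) ^ n * 4 ^ n := by rw [← mul_pow]; norm_num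
    rw [h, pow_succ, pow_add, mul_comm n 2, pow_mul]
    ring
  have hCn_le : Cn ≤ (1 + 2 * K₀) ^ 2 * 4 ^ n * (1 + 2 * K₀) ^ n := by
    have h1 : 1 + (n + 2 : ℝ) * K₀ ≤ (1 + 2 * K₀) * ((n : ℝ) + 1) := by nlinarith
    have h2 : ((n : ℝ) + 1) ≤ 2 ^ n := by
      have := Nat.lt_two_pow_self (n := n)
      exact_mod_cast this
    have h3 : (1 + (n + 2 : ℝ) * K₀) ^ 2 ≤ ((1 + 2 * K₀) * 2 ^ n) ^ 2 :=
      pow_le_pow_left₀ (by positivity) (h1.trans (mul_le_mul_of_nonneg_left h2 (by positivity))) 2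
    calc Cn = (1 + (n + 2 : ℝ) * K₀) ^ 2 * (1 + 2 * K₀) ^ n := rfl
      _ ≤ ((1 + 2 * K₀) * 2 ^ n) ^ 2 * (1 + 2 * K₀) ^ n := mul_le_mul_of_nonneg_right h3 (by positivity)
      _ = (1 + 2 * K₀) ^ 2 * 4 ^ n * (1 + 2 * K₀) ^ n := by
          rw [mul_pow, ← pow_mul, mul_comm n 2, pow_mul]; norm_num
  rw [gaussExpect_twoPoint_mul_hubbardInteraction_pow_eq_det hβ, norm_mul, norm_pow, Complex.norm_real,
    Real.norm_eq_abs]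
  set E : ℝ := Real.exp (β * r) * Real.exp ((β * K₀ + n * ∫ u, wr M u) * r * Real.exp (β * K₀ * r)) with hE
  have hE0 : 0 ≤ E := by positivity
  calc |U| ^ n * ‖∑ xv : Fin n → TorusSite 2 L, _‖
      ≤ |U| ^ n * ∑ xv : Fin n → TorusSite 2 L, (4 : ℝ) ^ (n * 2 + 1) * 4 ^ (n + 2) * (Cn * ((n ! : ℝ) / r ^ n *
          Real.exp (β * r) * Real.exp ((β * K₀ + n * ∫ u, wr M u) * r * Real.exp (β * K₀ * r)))) := by
        gcongr
        exact (norm_sum_le _ _).trans (sum_le_sum fun xv _ => hdet xv)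
    _ = |U| ^ n * ((L : ℝ) ^ 2) ^ n * (64 * 64 ^ n) * Cn * ((n ! : ℝ) / r ^ n) * E := by
        rw [sum_const, card_univ, nsmul_eq_mul, hcard, h64, hE]; ring
    _ ≤ |U| ^ n * ((L : ℝ) ^ 2) ^ n * (64 * 64 ^ n) * ((1 + 2 * K₀) ^ 2 * 4 ^ n * (1 + 2 * K₀) ^ n) *
          ((n ! : ℝ) / r ^ n) * E := by
        gcongr
    _ = (n ! : ℝ) * (64 * (1 + 2 * K₀) ^ 2 * E) * (256 * |U| * (L : ℝ) ^ 2 * (1 + 2 * K₀) / r) ^ n := by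
        have hr' : r ^ n ≠ 0 := pow_ne_zero _ hr.ne'
        have h256 : (256 : ℝ) ^ n = 64 ^ n * 4 ^ n := by rw [← mul_pow]; norm_num
        rw [div_pow, mul_pow, mul_pow, mul_pow, h256]
        field_simp
  -- unfold `E`
    _ = (n ! : ℝ) * (64 * (1 + 2 * K₀) ^ 2 * Real.exp (β * r) *
              Real.exp ((β * K₀ + n * ∫ u, wr M u) * r * Real.exp (β * K₀ * r))) *
            (256 * |U| * (L : ℝ) ^ 2 * (1 + 2 * K₀) / r) ^ n := by rw [hE]; ring

/-- **The `M → ∞` limit of the Grassmann two-point numerator for EVERY coupling, at GENERAL external times `sx, sy ∈ [0, β)`**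
(t2's `tendsto_gaussExpect_twoPoint_mul_grassmannExp_allU` is the case `sx = sy = 0`):
`∫dμ_{C_M} ψ⁺_{xₑσ}ψ⁻_{yₑσ'} e^{−V} ⟶ Σ'_n ((−1)ⁿ/n!) Uⁿ Σ_{x⃗} ∫_{[0,β]ⁿ} det[vertexLimitEntry on the 2n+1 pairs]` — the tree's
`tendsto_gaussExpect_twoPoint_mul_grassmannExp` WITHOUT `3e|U|L²βB² < 1`. -/
theorem tendsto_gaussExpect_twoPoint_mul_grassmannExp_allU_time {β : ℝ} (hβ : 0 < β) (μ U : ℝ) (σ σ' : Fin 2)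
    (xe ye : TorusSite 2 L) {sx sy : ℝ} (hsx : sx ∈ Set.Ico (0 : ℝ) β) (hsy : sy ∈ Set.Ico (0 : ℝ) β) :
    Tendsto (fun M : ℕ => gaussExpect ℂ (hubbardCovariance L M β μ 0)
        (positionField L M β 0 σ xe sx * positionField L M β 1 σ' ye sy * grassmannExp (-(hubbardInteraction L M β U))))
      atTop
      (𝓝 (∑' n : ℕ, ((-1 : ℂ) ^ n * ((n ! : ℂ))⁻¹) * ((U : ℂ) ^ n * ∑ x : Fin n → TorusSite 2 L,
        ∫ τ in Set.Icc (0 : Fin n → ℝ) (fun _ => β),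
          (Matrix.of fun i j : Fin (n * 2 + 1) =>
            vertexLimitEntry L β μ ((Fin.append x ![xe, ye] : Fin (n + 2) → TorusSite 2 L) (twoPointPlusEnum n σ i).1)
              ((Fin.append x ![xe, ye] : Fin (n + 2) → TorusSite 2 L) (twoPointMinusEnum n σ' j).1)
              (twoPointPlusEnum n σ i).2 (twoPointMinusEnum n σ' j).2
              ((Fin.append τ ![sx, sy] : Fin (n + 2) → ℝ) (twoPointMinusEnum n σ' j).1 -
                (Fin.append τ ![sx, sy] : Fin (n + 2) → ℝ) (twoPointPlusEnum n σ i).1)).det))) := by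
  obtain ⟨K₀, ε, hK₀, hε0, hεlim, hmom⟩ := norm_gaussExpect_twoPoint_pow_le_allU_time (L := L) hβ μ U σ σ' xe ye
    (Set.Ico_subset_Icc_self hsx) (Set.Ico_subset_Icc_self hsy)
  set r : ℝ := 512 * |U| * (L : ℝ) ^ 2 * (1 + 2 * K₀) + 1 with hr
  have hr0 : 0 < r := by positivity
  have hratio : 256 * |U| * (L : ℝ) ^ 2 * (1 + 2 * K₀) / r ≤ 1 / 2 := by
    rw [div_le_iff₀ hr0, hr]
    nlinarith [abs_nonneg U, sq_nonneg (L : ℝ), hK₀]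
  have hratio0 : 0 ≤ 256 * |U| * (L : ℝ) ^ 2 * (1 + 2 * K₀) / r := by positivity
  set A : ℝ := r * Real.exp (β * K₀ * r) with hA
  have hA0 : 0 < A := by positivity
  have hev : ∀ᶠ M in atTop, ε M * A ≤ 1 / 4 := by
    have h1 : Tendsto (fun M => ε M * A) atTop (𝓝 (0 * A)) := hεlim.mul_const A
    rw [zero_mul] at h1
    exact (h1.eventually (ge_mem_nhds (by norm_num : (0 : ℝ) < 1 / 4))).mono fun M hM => hM
  set D : ℝ := 64 * (1 + 2 * K₀) ^ 2 * Real.exp (β * r) * Real.exp (β * K₀ * A) with hD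
  have hZ : ∀ M : ℕ, gaussExpect ℂ (hubbardCovariance L M β μ 0)
      (positionField L M β 0 σ xe sx * positionField L M β 1 σ' ye sy * grassmannExp (-(hubbardInteraction L M β U))) =
      ∑' n : ℕ, ((-1 : ℂ) ^ n * ((n ! : ℂ))⁻¹) * gaussExpect ℂ (hubbardCovariance L M β μ 0)
        (positionField L M β 0 σ xe sx * positionField L M β 1 σ' ye sy * hubbardInteraction L M β U ^ n) := fun M =>
    gaussExpect_mul_grassmannExp_neg_eq_tsum _ _ (constPart_hubbardInteraction L M β U)
  simp_rw [hZ]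
  refine tendsto_tsum_of_dominated_convergence (bound := fun n => D * (3 / 4 : ℝ) ^ n) ?_ (fun n => ?_) ?_
  · exact (summable_geometric_of_lt_one (by norm_num) (by norm_num)).mul_left D
  · exact (tendsto_gaussExpect_twoPoint_mul_hubbardInteraction_pow hβ μ U σ σ' xe ye hsx hsy n).const_mul _
  · filter_upwards [hev] with M hM n
    have hεA1 : |ε M * A| ≤ 1 := by
      rw [abs_of_nonneg (mul_nonneg (hε0 M) hA0.le)]; linarith
    have hexp : Real.exp (ε M * A) ≤ 3 / 2 := by
      have h := Real.abs_exp_sub_one_le hεA1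
      rw [abs_of_nonneg (mul_nonneg (hε0 M) hA0.le)] at h
      have h' := (abs_le.mp h).2
      linarith
    rw [norm_mul, norm_mul, norm_pow, norm_neg, norm_one, one_pow, one_mul, norm_inv, Complex.norm_natCast]
    have hfac : (0 : ℝ) < n ! := by exact_mod_cast Nat.factorial_pos n
    have hkey := hmom M n r hr0
    have hsplit : Real.exp ((β * K₀ + n * ε M) * r * Real.exp (β * K₀ * r)) =
        Real.exp (β * K₀ * A) * Real.exp (ε M * A) ^ n := by
      rw [← Real.exp_nat_mul, ← Real.exp_add, hA]
      ring_nf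
    calc ((n ! : ℝ))⁻¹ * ‖gaussExpect ℂ (hubbardCovariance L M β μ 0)
          (positionField L M β 0 σ xe sx * positionField L M β 1 σ' ye sy * hubbardInteraction L M β U ^ n)‖
        ≤ ((n ! : ℝ))⁻¹ * ((n ! : ℝ) * (64 * (1 + 2 * K₀) ^ 2 * Real.exp (β * r) *
            Real.exp ((β * K₀ + n * ε M) * r * Real.exp (β * K₀ * r))) *
            (256 * |U| * (L : ℝ) ^ 2 * (1 + 2 * K₀) / r) ^ n) := by
          gcongr
      _ = D * (Real.exp (ε M * A) * (256 * |U| * (L : ℝ) ^ 2 * (1 + 2 * K₀) / r)) ^ n := by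
          rw [hsplit, hD, mul_pow]
          field_simp
      _ ≤ D * (3 / 4 : ℝ) ^ n := by
          gcongr
          calc Real.exp (ε M * A) * (256 * |U| * (L : ℝ) ^ 2 * (1 + 2 * K₀) / r) ≤ (3 / 2) * (1 / 2) :=
                mul_le_mul hexp hratio hratio0 (by norm_num)
            _ = 3 / 4 := by norm_num



/-- **UNIFORM form of `norm_gaussExpect_twoPoint_pow_le_allU_time`**: the constants `K₀`, `ε_M` depend only on `(β, μ, L)` — NOT on the spins,
the sites or the external times `s_x, s_y ∈ [0, β]` (they come from `exists_remainderKernel`).  This is the `t`-UNIFORM, `M`-uniform majorant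
needed to dominate the space–time average of the local insertion (`…VolumeLimitHartreeAverage`, TAU-BRIDGE §6 Step 2). -/
theorem norm_gaussExpect_twoPoint_pow_le_allU_time_uniform {β : ℝ} (hβ : 0 < β) (μ U : ℝ) :
    ∃ (K₀ : ℝ) (ε : ℕ → ℝ), 0 ≤ K₀ ∧ (∀ M, 0 ≤ ε M) ∧ Tendsto ε atTop (𝓝 0) ∧
      ∀ (σ σ' : Fin 2) (xe ye : TorusSite 2 L) (sx sy : ℝ), sx ∈ Set.Icc (0 : ℝ) β → sy ∈ Set.Icc (0 : ℝ) β →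
      ∀ (M n : ℕ) (r : ℝ), 0 < r →
        ‖gaussExpect ℂ (hubbardCovariance L M β μ 0)
            (positionField L M β 0 σ xe sx * positionField L M β 1 σ' ye sy * hubbardInteraction L M β U ^ n)‖ ≤
          (n ! : ℝ) * (64 * (1 + 2 * K₀) ^ 2 * Real.exp (β * r) *
              Real.exp ((β * K₀ + n * ε M) * r * Real.exp (β * K₀ * r))) *
            (256 * |U| * (L : ℝ) ^ 2 * (1 + 2 * K₀) / r) ^ n := by
  classical
  obtain ⟨K₀, wr, hK₀, hwm, hw0, hwK, hwI, hshift, hlim, hkey⟩ := exists_remainderKernel L hβ μ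
  refine ⟨K₀, fun M => ∫ u, wr M u, hK₀, fun M => integral_nonneg fun u => hw0 M u, hlim, ?_⟩
  intro σ σ' xe ye sx sy hsx hsy M n r hr
  have hcard : ((Fintype.card (Fin n → TorusSite 2 L) : ℕ) : ℝ) = ((L : ℝ) ^ 2) ^ n := by
    rw [Fintype.card_fun, Fintype.card_fin, Nat.cast_pow, Fintype.card_pi, prod_const, ZMod.card, card_univ,
      Fintype.card_fin, Nat.cast_pow]
  have hfibP : ∀ a : Fin (n + 2), (univ.filter fun i : Fin (n * 2 + 1) => (twoPointPlusEnum n σ i).1 = a).card ≤ 2 :=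
    card_filter_fst_le_two _ (twoPointPlusEnum_injective n σ)
  have hfibQ : ∀ a : Fin (n + 2), (univ.filter fun j : Fin (n * 2 + 1) => (twoPointMinusEnum n σ' j).1 = a).card ≤ 2 :=
    card_filter_fst_le_two _ (twoPointMinusEnum_injective n σ')
  have hI := integral_sum_prod_sum_le (m := n) β hβ.le (wr M) (hwm M) (hw0 M) K₀ (∫ u, wr M u) hK₀
    (integral_nonneg fun u => hw0 M u) (hwK M) (hshift M) r hr
  set Cn : ℝ := (1 + (n + 2 : ℝ) * K₀) ^ 2 * (1 + 2 * K₀) ^ n with hCn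
  have hCn0 : 0 ≤ Cn := by positivity
  have hdet : ∀ xv : Fin n → TorusSite 2 L, ‖∫ τ in Set.Icc (0 : Fin n → ℝ) (fun _ => β),
      (Matrix.of fun i j : Fin (n * 2 + 1) =>
        -((vertexSubMatrix L M β (Fin.append xv ![xe, ye]) (Fin.append τ ![sx, sy])).transpose *
            hubbardCovariance L M β μ 0 *
            vertexSubMatrix L M β (Fin.append xv ![xe, ye]) (Fin.append τ ![sx, sy]))
          ((twoPointPlusEnum n σ i, 0) : VertexLeg (n + 2)) ((twoPointMinusEnum n σ' j, 1) : VertexLeg (n + 2))).det‖ ≤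
      (4 : ℝ) ^ (n * 2 + 1) * 4 ^ (n + 2) * (Cn * ((n ! : ℝ) / r ^ n * Real.exp (β * r) *
        Real.exp ((β * K₀ + n * ∫ u, wr M u) * r * Real.exp (β * K₀ * r)))) := by
    intro xv
    refine (norm_integral_le_of_norm_le (((integrableOn_sum_prod_sum β (wr M) (hwm M) (hw0 M) K₀ (hwK M)).const_mul
      ((4 : ℝ) ^ (n * 2 + 1) * 4 ^ (n + 2) * Cn))) ?_).trans ?_
    · refine (ae_restrict_iff' measurableSet_Icc).2 (ae_of_all _ fun τ hτ => ?_)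
      have hτ' : ∀ a : Fin (n + 2), (Fin.append τ ![sx, sy] : Fin (n + 2) → ℝ) a ∈ Set.Icc (0 : ℝ) β := by
        intro a
        refine Fin.addCases (fun a₀ => ?_) (fun k => ?_) a
        · rw [Fin.append_left]; exact ⟨hτ.1 a₀, hτ.2 a₀⟩
        · rw [Fin.append_right]
          fin_cases k
          · simpa using hsx
          · simpa using hsy
      refine (norm_det_vertexWick_le_sum_prod hβ μ _ _ hτ' _ _ hfibP hfibQ (wr M) (hw0 M) (hkey M)).trans ?_
      rw [mul_assoc ((4 : ℝ) ^ (n * 2 + 1) * 4 ^ (n + 2)) Cn]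
      exact mul_le_mul_of_nonneg_left (sum_prod_sum_append_le_time (wr M) (hw0 M) K₀ (hwK M) τ ![sx, sy]) (by positivity)
    · rw [integral_const_mul, mul_assoc]
      exact mul_le_mul_of_nonneg_left (mul_le_mul_of_nonneg_left hI hCn0) (by positivity)
  have h64 : (4 : ℝ) ^ (n * 2 + 1) * 4 ^ (n + 2) = 64 * 64 ^ n := by
    have h : (64 : ℝ) ^ n = (4 ^ 2) ^ n * 4 ^ n := by rw [← mul_pow]; norm_num
    rw [h, pow_succ, pow_add, mul_comm n 2, pow_mul]
    ring
  have hCn_le : Cn ≤ (1 + 2 * K₀) ^ 2 * 4 ^ n * (1 + 2 * K₀) ^ n := by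
    have h1 : 1 + (n + 2 : ℝ) * K₀ ≤ (1 + 2 * K₀) * ((n : ℝ) + 1) := by nlinarith
    have h2 : ((n : ℝ) + 1) ≤ 2 ^ n := by
      have := Nat.lt_two_pow_self (n := n)
      exact_mod_cast this
    have h3 : (1 + (n + 2 : ℝ) * K₀) ^ 2 ≤ ((1 + 2 * K₀) * 2 ^ n) ^ 2 :=
      pow_le_pow_left₀ (by positivity) (h1.trans (mul_le_mul_of_nonneg_left h2 (by positivity))) 2
    calc Cn = (1 + (n + 2 : ℝ) * K₀) ^ 2 * (1 + 2 * K₀) ^ n := rfl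
      _ ≤ ((1 + 2 * K₀) * 2 ^ n) ^ 2 * (1 + 2 * K₀) ^ n := mul_le_mul_of_nonneg_right h3 (by positivity)
      _ = (1 + 2 * K₀) ^ 2 * 4 ^ n * (1 + 2 * K₀) ^ n := by
          rw [mul_pow, ← pow_mul, mul_comm n 2, pow_mul]; norm_num
  rw [gaussExpect_twoPoint_mul_hubbardInteraction_pow_eq_det hβ, norm_mul, norm_pow, Complex.norm_real,
    Real.norm_eq_abs]
  set E : ℝ := Real.exp (β * r) * Real.exp ((β * K₀ + n * ∫ u, wr M u) * r * Real.exp (β * K₀ * r)) with hE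
  have hE0 : 0 ≤ E := by positivity
  calc |U| ^ n * ‖∑ xv : Fin n → TorusSite 2 L, _‖
      ≤ |U| ^ n * ∑ xv : Fin n → TorusSite 2 L, (4 : ℝ) ^ (n * 2 + 1) * 4 ^ (n + 2) * (Cn * ((n ! : ℝ) / r ^ n *
          Real.exp (β * r) * Real.exp ((β * K₀ + n * ∫ u, wr M u) * r * Real.exp (β * K₀ * r)))) := by
        gcongr
        exact (norm_sum_le _ _).trans (sum_le_sum fun xv _ => hdet xv)
    _ = |U| ^ n * ((L : ℝ) ^ 2) ^ n * (64 * 64 ^ n) * Cn * ((n ! : ℝ) / r ^ n) * E := by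
        rw [sum_const, card_univ, nsmul_eq_mul, hcard, h64, hE]; ring
    _ ≤ |U| ^ n * ((L : ℝ) ^ 2) ^ n * (64 * 64 ^ n) * ((1 + 2 * K₀) ^ 2 * 4 ^ n * (1 + 2 * K₀) ^ n) *
          ((n ! : ℝ) / r ^ n) * E := by
        gcongr
    _ = (n ! : ℝ) * (64 * (1 + 2 * K₀) ^ 2 * E) * (256 * |U| * (L : ℝ) ^ 2 * (1 + 2 * K₀) / r) ^ n := by
        have hr' : r ^ n ≠ 0 := pow_ne_zero _ hr.ne'
        have h256 : (256 : ℝ) ^ n = 64 ^ n * 4 ^ n := by rw [← mul_pow]; norm_num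
        rw [div_pow, mul_pow, mul_pow, mul_pow, h256]
        field_simp
  -- unfold `E`
    _ = (n ! : ℝ) * (64 * (1 + 2 * K₀) ^ 2 * Real.exp (β * r) *
              Real.exp ((β * K₀ + n * ∫ u, wr M u) * r * Real.exp (β * K₀ * r))) *
            (256 * |U| * (L : ℝ) ^ 2 * (1 + 2 * K₀) / r) ^ n := by rw [hE]; ring

end

end Summit.HubbardSuperconductivity.HubbardSuperconductivity.Theorems.MatsubaraAllU
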